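import Summits.Ventures.CertifiedManyBodySolver.Downfold.EmeryOrbitalWeightFaceDirBox
import Summits.Ventures.CertifiedManyBodySolver.Downfold.EmeryOrbitalWeightFaceDirCertW
import HarnessLib

/-!
# THE REGIME-FREE ANTINODAL BOX RULE ON THE WIDE WINDOW: `dWeightFace_fermiEnergyOf_mem_Icc_of_mem_box4_dirW_num` — the four-coordinate corner rule of
# `EmeryOrbitalWeightFaceDirBox` with the directional certificate of `EmeryOrbitalWeightFaceDirCertW` (ε/t_pd up to 11/5 instead of 2), so that the
# ELECTRON-DOPED NCCO (K) box (ε_F/t_pd ≤ 2.12) is covered (INFL-3to1-B §B.91 (h))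

Venture CertifiedManyBodySolver, cell `pub/hubbard-downfold` (stage S1; INFLATION-RULES-3to1-B §B.91), seat hubbard-downfold-mod-4 (technique B, g40); namespace
`Summit.Ventures.CertifiedManyBodySolver.Downfold.Emery`. Everything PROVED (0 sorry): the statement and proof are those of
`dWeightFace_fermiEnergyOf_mem_Icc_of_mem_box3_dir_num` (§B.90 (j): Δ-step at fixed filling by the one-point directional certificate + the Fermi-energy slope law +
the mean value theorem; t_pp step; t_pp′ step at the upper corner; t_pp′-decoupled lower edge; t_pd removed by normalisation) with the region hypothesis discharged by
`faceDirW_nonneg_of_mem_region` on `Δ/t_pd ∈ [7/10, 16/5] × ε/t_pd ∈ [7/10, 11/5] × t_pp/t_pd ∈ [3/10, 4/5] × t_pp′/t_pd ∈ [0, 1/5]` ∩ `faceG ≥ 0`.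
WHAT THIS IS NOT: a statement about any material; `U = 0` one-body kinematics of the σ model.

Sources: three-band model [HybertsenSchluterChristensen1989, Eq. (1)]; [AndersenEtAl1995, §6]; [folklore] algebra.
-/

noncomputable section

namespace Summit.Ventures.CertifiedManyBodySolver.Downfold.Emery

open Real Set

/-- **THE ANTINODAL WINDOW OVER A FOUR-COORDINATE BOX, regime-free rule, WIDE certificate window** (`Eh ≤ 11/5`): for every member of
`[Δ₁, Δ₂] × [a₁, a₂] × [b₁, b₂] × [c₁, c₂]` the antinodal Fermi-surface Cu-d weight lies in `[lo, hi]` under the numeric side conditions of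
`…_box4_dir_num` (normalised corners, brackets `E_h`, `E_v`, slope constant `κ ≥ 1/10`). [folklore] -/
theorem dWeightFace_fermiEnergyOf_mem_Icc_of_mem_box4_dirW_num {Δ a b c Δ₁ Δ₂ a₁ a₂ b₁ b₂ c₁ c₂ ν Eh Ev Elow κ lo hi : ℝ} (hΔ₁ : 0 < Δ₁) (ha₁ : 0 < a₁)
    (hc₁ : 0 ≤ c₁) (hb₁ : 0 < b₁) (hcb : c₂ / a₁ ≤ b₁ / a₂) (hΔ : Δ ∈ Icc Δ₁ Δ₂) (ha : a ∈ Icc a₁ a₂) (hb : b ∈ Icc b₁ b₂) (hc : c ∈ Icc c₁ c₂)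
    (hν0 : 0 < ν) (hν1 : ν < 1)
    (hVH : ∀ Δ' b' c' : ℝ, Δ' ∈ Icc (Δ₁ / a₂) (Δ₂ / a₁) → b' ∈ Icc (b₁ / a₂) (b₂ / a₁) → c' ∈ Icc (c₁ / a₂) (c₂ / a₁) → 1 - 2 * ν ≤ xVH Δ' 1 b' c')
    (hEh : fermiEnergyOf (Δ₁ / a₂) 1 (b₂ / a₁) (c₁ / a₂) ν ≤ Eh) (hm : c₂ / a₁ * Eh < 1)
    (hU11 : 0 ≤ faceU (Δ₁ / a₂) 1 (b₁ / a₂) (c₁ / a₂) Eh) (hU12 : 0 ≤ faceU (Δ₁ / a₂) 1 (b₁ / a₂) (c₂ / a₁) Eh)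
    (hU21 : 0 ≤ faceU (Δ₂ / a₁) 1 (b₁ / a₂) (c₁ / a₂) Eh) (hU22 : 0 ≤ faceU (Δ₂ / a₁) 1 (b₁ / a₂) (c₂ / a₁) Eh)
    (hEv : Ev ≤ fermiEnergyOf (Δ₂ / a₁) 1 (b₁ / a₂) (c₂ / a₁) ν) (hEv0 : 0 < Ev) (hR2 : 4 * (b₁ / a₂ + c₂ / a₁) ≤ Δ₂ / a₁ + Ev)
    (hGv : 0 ≤ faceG (Δ₂ / a₁) 1 (c₂ / a₁) Ev)
    (hElow : 0 < Elow) (hEl : Elow < Ev) (hκ : 1 / 10 ≤ κ) (hκW : κ + dWeightAxisCF (Δ₂ / a₁) 1 (c₂ / a₁) Elow < 1)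
    (hlev : c₂ / a₁ * (Δ₁ / a₂ * (Elow + Eh) + Elow * Eh) ≤ 1 * (Δ₁ / a₂)) (hsl : c₂ / a₁ * (Elow + Eh) ≤ 1)
    (hrD1 : 7 / 10 ≤ Δ₁ / a₂) (hrD2 : Δ₂ / a₁ ≤ 16 / 5) (hrb1 : 3 / 10 ≤ b₁ / a₂) (hrb2 : b₂ / a₁ ≤ 4 / 5) (hrc2 : c₂ / a₁ ≤ 1 / 5)
    (hrEv : 7 / 10 ≤ Ev) (hrEh : Eh ≤ 11 / 5)
    (hlo : lo ≤ dWeightFaceLoDec (Δ₁ / a₂) 1 (b₂ / a₁) (c₁ / a₂) (c₂ / a₁) Eh) (hhi : dWeightFaceCF (Δ₂ / a₁) 1 (b₁ / a₂) (c₂ / a₁) Ev ≤ hi) :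
    dWeightFace Δ a b c (fermiEnergyOf Δ a b c ν) ∈ Icc lo hi := by
  have ha0 : 0 < a := lt_of_lt_of_le ha₁ ha.1
  have ha₂ : 0 < a₂ := lt_of_lt_of_le ha0 ha.2
  have hc₁n : 0 ≤ c₁ / a₂ := div_nonneg hc₁ ha₂.le
  have hb₁n : 0 < b₁ / a₂ := div_pos hb₁ ha₂
  rw [dWeightFace_fermiEnergyOf_eq_ratios ha0]
  have hΔn := div_mem_Icc_of_mem ha₁ hΔ₁.le hΔ ha
  have hbn := div_mem_Icc_of_mem ha₁ hb₁.le hb ha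
  have hcn := div_mem_Icc_of_mem ha₁ hc₁ hc ha
  refine dWeightFace_fermiEnergyOf_mem_Icc_of_mem_box3_dir_num (κ₀ := 1 / 10) (div_pos hΔ₁ ha₂) one_pos hc₁n hcb hb₁n hΔn hbn hcn hν0 hν1
    hVH hEh (by simpa using hm) hU11 hU12 hU21 hU22 hEv hEv0 hR2 hGv hElow hEl (by norm_num) hκ hκW (by simpa using hlev) (by simpa using hsl) ?_ hlo hhi
  intro D B C e hD hB hC he hG
  exact faceDirW_nonneg_of_mem_region ⟨hrD1.trans hD.1, hD.2.trans hrD2⟩ ⟨hrEv.trans he.1, he.2.trans hrEh⟩ ⟨hrb1.trans hB.1, hB.2.trans hrb2⟩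
    ⟨hc₁n.trans hC.1, hC.2.trans hrc2⟩ hG


end Summit.Ventures.CertifiedManyBodySolver.Downfold.Emery
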